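import Summits.QuantumAdvantage.QuantumAdvantage.Theorems.SosSandwichTransferPBMachineDefs
import HarnessLib

/-!
# Crux `TransferPB` (stmt-QuantumAdvantage-15238, route SosSandwich), line `birth` — operational reading of the advised tree (for the machine (M))

Obligation (M) of `Theorems/SosSandwichTransferPBMachineSplit.lean` asks for a transcript machine whose output is
`[ (advTree (derivedAdvisor F x g) D []).eval (oracleBits F x A) ≥ 1/2 ]`. A machine does not build the tree; it
WALKS it: ask the advisor for a bit, read that bit of `A` (one oracle query `false :: σ(s)` of the combined oracle),
extend the path, repeat while the budget lasts, then output the advisor's leaf value. This file states that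
reading as rewriting lemmas (def-free):

* `advTree_eval_succ_some` / `advTree_eval_succ_none` / `advTree_eval_zero'` — one step of the walk:
  `(advTree A (D+1) ρ).eval y = (advTree A D (ρ ++ [(i, y i)])).eval y` when `A.pick ρ = some i`, and the leaf
  value `A.val ρ` at a refusal or when the budget is exhausted;
* `oracleBits_eq_true_iff` — the relevant bit `s` of the oracle `A` is `[σ(s) ∈ A]`
  (`σ = bitString F x`), i.e. exactly the answer of the combined oracle to the query `false :: σ(s)`
  (`combine_false_cons_iff`).

All proved; no named fact. Source: S. Aaronson, A. Ambainis, Theory Comput. 10 (2014), proof of Thm. 23 (p. 14: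
the machine `C` runs the tree, querying `A` at the chosen variable).
-/

-- D-0017: single-conjunct summit ⇒ the duplicate `QuantumAdvantage.QuantumAdvantage` is mandated.
set_option linter.dupNamespace false

noncomputable section

namespace Summit.QuantumAdvantage.QuantumAdvantage.Cruxes.TransferPB.Birth

open Finset Literature.Computability.Cryptography Literature.Computability.Complexity
  Literature.Computability.QuantumComplexity

namespace SimTreePB

section Walk

variable {N : ℕ} (A : Advisor N)

/-- **One step of the walk (query).** If the advisor picks `i` at `ρ`, the advised tree with budget `D + 1`
evaluates at `y` as the subtree along the revealed bit `y i` with budget `D`. [cite: AaronsonAmbainis2014, Thm. 23 (proof, p. 14)] -/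
theorem advTree_eval_succ_some {D : ℕ} {ρ : List (Fin N × Bool)} {i : Fin N} (h : A.pick ρ = some i)
    (y : Fin N → Bool) :
    (advTree A (D + 1) ρ).eval y = (advTree A D (ρ ++ [(i, y i)])).eval y := by
  rw [advTree_succ_of_some A h, RealDecisionTree.eval_query]
  cases y i <;> simp

/-- **One step of the walk (refusal).** If the advisor refuses at `ρ`, the output is the leaf value. [folklore] -/
theorem advTree_eval_succ_none {D : ℕ} {ρ : List (Fin N × Bool)} (h : A.pick ρ = none) (y : Fin N → Bool) :
    (advTree A (D + 1) ρ).eval y = A.val ρ := by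
  rw [advTree_succ_of_none A h, RealDecisionTree.eval_leaf]

/-- **Budget exhausted**: the output is the leaf value. [folklore] -/
theorem advTree_eval_zero' (ρ : List (Fin N × Bool)) (y : Fin N → Bool) :
    (advTree A 0 ρ).eval y = A.val ρ := by
  rw [advTree_zero, RealDecisionTree.eval_leaf]

end Walk

section Oracle

variable (F : QCircuitFamily cliffordT) (x : List Bool)

/-- **The relevant bit `s` of the oracle `A` is `[σ(s) ∈ A]`.** [folklore] -/
theorem oracleBits_eq_true_iff (A : Set (List Bool)) (s : Fin (numOracleBits F x)) :
    oracleBits F x A s = true ↔ bitString F x s ∈ A := by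
  unfold oracleBits bitString
  exact restrictBool_eq_true_iff _ _ _

/-- The relevant bit as a `decide`. [folklore] -/
theorem oracleBits_eq_decide (A : Set (List Bool)) (s : Fin (numOracleBits F x)) :
    oracleBits F x A s = @decide (bitString F x s ∈ A) (Classical.propDecidable _) := by
  unfold oracleBits bitString
  exact restrictBool_apply _ _ _

/-- **The combined oracle answers `false :: v` by `[v ∈ A]`** (and `true :: v` by `g v`): the `A`-query the machine
makes for the picked bit. [folklore] -/
theorem combine_false_cons_iff (A : Set (List Bool)) (g : List Bool → Bool) (v : List Bool) :
    (false :: v) ∈ {w : List Bool | ∃ v' : List Bool, (w = false :: v' ∧ v' ∈ A) ∨ (w = true :: v' ∧ g v' = true)} ↔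
      v ∈ A := by
  simp only [Set.mem_setOf_eq]
  constructor
  · rintro ⟨v', ⟨hw, hv⟩ | ⟨hw, -⟩⟩
    · rw [(List.cons_eq_cons.1 hw).2]; exact hv
    · exact absurd (List.cons_eq_cons.1 hw).1 (by simp)
  · intro hv; exact ⟨v, Or.inl ⟨rfl, hv⟩⟩

/-- The combined oracle answers `true :: v` by `g v`. [folklore] -/
theorem combine_true_cons_iff (A : Set (List Bool)) (g : List Bool → Bool) (v : List Bool) :
    (true :: v) ∈ {w : List Bool | ∃ v' : List Bool, (w = false :: v' ∧ v' ∈ A) ∨ (w = true :: v' ∧ g v' = true)} ↔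
      g v = true := by
  simp only [Set.mem_setOf_eq]
  constructor
  · rintro ⟨v', ⟨hw, -⟩ | ⟨hw, hg⟩⟩
    · exact absurd (List.cons_eq_cons.1 hw).1 (by simp)
    · rw [(List.cons_eq_cons.1 hw).2]; exact hg
  · intro hg; exact ⟨v, Or.inr ⟨rfl, hg⟩⟩

end Oracle

end SimTreePB

end Summit.QuantumAdvantage.QuantumAdvantage.Cruxes.TransferPB.Birth

end
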